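import Mathlib
import HarnessLib
import Literature.MathematicalPhysics.QuantumManyBody.BoseGasFreeDirichletBEC
import Summits.AtomisticToContinuum.BoseEinsteinCondensation.Theorems.NumberPhaseSandwichBumpProfile
import Summits.AtomisticToContinuum.BoseEinsteinCondensation.Theorems.NumberPhaseSandwichKinematicCalculus

/-! # NumberPhaseSandwich · bump calculus, part 2 of 3 — the three-dimensional cell bumps `h_c`

Helper toward the registered stub `stub_nearPivot_of_kinematic` (crux `FluctuationFloor`, stmt-AtomisticToContinuum-32638, route
NumberPhaseSandwich; decomp-a2c lens-6 g10, LAND ASK-6). The route's bump `bump ℓ c` (VERBATIM text of the registered skeleton):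
`bump = ∏_j τ(t_j)`, `C^∞`; the gradient formula `∂_k h_c = (∏_{j≠k} τ(t_j))·τ′(t_k)/ℓ`, `|∂_k h_c| ≤ (8C_σ/ℓ)·1_{Q_c}`; the
second-derivative formula and `|∂_k∂_k h_c| ≤ (C₂/ℓ²)·1_{Q_c}`; on the gradient shell of `c` (skeleton's `shell`, verbatim):
`∂₀ h_c ≥ 4c_σ/ℓ` and `∂_k h_{c'} = 0` for `c' ≠ c`, hence `(∂₀ g)² ≥ (4c_σ/ℓ)²`. The coordinate direction `e` and the partial
derivative `pd` are those of the landed kinematic-floor calculus (`NumberPhaseSandwichKinematicCalculus`, same text), so the floor applies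
to these bumps by `rfl`. No sorry. -/

noncomputable section

namespace Summit.AtomisticToContinuum.BoseEinsteinCondensation.Theorems.NumberPhaseSandwichBumpCalculus

open Real Set Filter Topology
open Summit.AtomisticToContinuum.BoseEinsteinCondensation.Theorems.NumberPhaseSandwichBumpProfile
open Summit.AtomisticToContinuum.BoseEinsteinCondensation.Theorems.NumberPhaseSandwichKinematicCalculus

/-! ## The three-dimensional cell bumps `h_c` -/

section Bump3D

open Literature.MathematicalPhysics.QuantumManyBody.BoseGas

variable {n : ℕ}

/-- the route's cell bump (VERBATIM text of the route file / registered skeletons). -/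
abbrev bump (ℓ : ℝ) (c : SubIdx n) (x : Space) : ℝ :=
  ∏ j : Fin 3, (Real.smoothTransition (4 * ((x j - ℓ * ((c j : ℕ) : ℝ)) / ℓ))) *
    Real.smoothTransition (4 * (1 - (x j - ℓ * ((c j : ℕ) : ℝ)) / ℓ))

/-- the cell coordinate `t_j(x) = (x_j − ℓ c_j)/ℓ`. -/
def tc (ℓ : ℝ) (c : SubIdx n) (j : Fin 3) (x : Space) : ℝ := (x j - ℓ * ((c j : ℕ) : ℝ)) / ℓ

/-- the `j`-th factor `Φ_j(x) = τ(t_j(x))`. -/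
def Phi (ℓ : ℝ) (c : SubIdx n) (j : Fin 3) (x : Space) : ℝ := tau (tc ℓ c j x)

/-- `bump = ∏_j Φ_j`. -/
theorem bump_eq_prod (ℓ : ℝ) (c : SubIdx n) : bump ℓ c = fun x => ∏ j : Fin 3, Phi ℓ c j x := by
  funext x; rfl

/-- `proj_i (e_k) = δ_{ik}`. -/
theorem proj_e (i k : Fin 3) : (EuclideanSpace.proj i : Space →L[ℝ] ℝ) (e k) = if i = k then 1 else 0 := by
  rw [EuclideanSpace.coe_proj]
  simp only [e]
  by_cases h : i = k
  · subst h; simp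
  · simp [h]

variable {ℓ : ℝ}

/-- Fréchet derivative of the factor `Φ_j`. -/
theorem hasFDerivAt_Phi (c : SubIdx n) (j : Fin 3) (x : Space) :
    HasFDerivAt (Phi ℓ c j) ((tauDeriv (tc ℓ c j x) / ℓ) • (EuclideanSpace.proj j : Space →L[ℝ] ℝ)) x := by
  have h1 : HasDerivAt (fun s : ℝ => tau ((s - ℓ * ((c j : ℕ) : ℝ)) / ℓ))
      (tauDeriv (tc ℓ c j x) * (1 / ℓ)) (x j) :=
    (hasDerivAt_tau _).comp (x j) (((hasDerivAt_id' (x j)).sub_const _).div_const ℓ)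
  have h2 : HasFDerivAt (fun y : Space => y j) (EuclideanSpace.proj j : Space →L[ℝ] ℝ) x :=
    (EuclideanSpace.proj j : Space →L[ℝ] ℝ).hasFDerivAt
  have h := h1.comp_hasFDerivAt x h2
  refine h.congr_fderiv ?_
  rw [mul_one_div]

/-- Fréchet derivative of the bump (product rule). -/
theorem hasFDerivAt_bump (c : SubIdx n) (x : Space) :
    HasFDerivAt (bump ℓ c) (∑ i : Fin 3, (∏ j ∈ Finset.univ.erase i, Phi ℓ c j x) •
      ((tauDeriv (tc ℓ c i x) / ℓ) • (EuclideanSpace.proj i : Space →L[ℝ] ℝ))) x := by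
  rw [bump_eq_prod]
  exact HasFDerivAt.finsetProd fun i _ => hasFDerivAt_Phi c i x

/-- **gradient formula**: `∂_k h_c(x) = (∏_{j ≠ k} Φ_j(x)) · τ′(t_k(x))/ℓ`. -/
theorem pd_bump (c : SubIdx n) (k : Fin 3) (x : Space) :
    pd (bump ℓ c) k x = (∏ j ∈ Finset.univ.erase k, Phi ℓ c j x) * (tauDeriv (tc ℓ c k x) / ℓ) := by
  rw [pd, (hasFDerivAt_bump c x).fderiv]
  have h : ∀ i : Fin 3, ((∏ j ∈ Finset.univ.erase i, Phi ℓ c j x) •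
      ((tauDeriv (tc ℓ c i x) / ℓ) • (EuclideanSpace.proj i : Space →L[ℝ] ℝ))) (e k) =
      if i = k then (∏ j ∈ Finset.univ.erase k, Phi ℓ c j x) * (tauDeriv (tc ℓ c k x) / ℓ) else 0 := by
    intro i
    change (∏ j ∈ Finset.univ.erase i, Phi ℓ c j x) • ((tauDeriv (tc ℓ c i x) / ℓ) •
      (EuclideanSpace.proj i : Space →L[ℝ] ℝ) (e k)) = _
    rw [proj_e]
    by_cases hik : i = k
    · subst hik; simp [smul_eq_mul]
    · simp [hik]
  rw [sum_apply]
  simp_rw [h]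
  rw [Finset.sum_ite_eq' Finset.univ k]
  simp

/-- `Φ_j ≥ 0`. -/
theorem Phi_nonneg (c : SubIdx n) (j : Fin 3) (x : Space) : 0 ≤ Phi ℓ c j x := tau_nonneg _
/-- `Φ_j ≤ 1`. -/
theorem Phi_le_one (c : SubIdx n) (j : Fin 3) (x : Space) : Phi ℓ c j x ≤ 1 := tau_le_one _

/-- products of the `Φ_j` are `≥ 0`. -/
theorem prod_Phi_nonneg (c : SubIdx n) (s : Finset (Fin 3)) (x : Space) : 0 ≤ ∏ j ∈ s, Phi ℓ c j x :=
  Finset.prod_nonneg fun j _ => Phi_nonneg c j x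
/-- products of the `Φ_j` are `≤ 1`. -/
theorem prod_Phi_le_one (c : SubIdx n) (s : Finset (Fin 3)) (x : Space) : ∏ j ∈ s, Phi ℓ c j x ≤ 1 :=
  Finset.prod_le_one (fun j _ => Phi_nonneg c j x) fun j _ => Phi_le_one c j x

/-- **gradient sup bound**: `|∂_k h_c| ≤ 8C_σ/ℓ` (`C_σ` = a global bound of `|σ′|`, `ℓ > 0`). -/
theorem abs_pd_bump_le (hℓ : 0 < ℓ) {C : ℝ} (hC : ∀ x : ℝ, |sigmaDeriv x| ≤ C) (c : SubIdx n) (k : Fin 3)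
    (x : Space) : |pd (bump ℓ c) k x| ≤ 8 * C / ℓ := by
  rw [pd_bump, abs_mul, abs_of_nonneg (prod_Phi_nonneg c _ x), abs_div, abs_of_pos hℓ]
  have h1 := prod_Phi_le_one (ℓ := ℓ) c (Finset.univ.erase k) x
  have h2 := abs_tauDeriv_le hC (tc ℓ c k x)
  have h3 : |tauDeriv (tc ℓ c k x)| / ℓ ≤ 8 * C / ℓ := div_le_div_of_nonneg_right h2 hℓ.le
  have h4 : 0 ≤ |tauDeriv (tc ℓ c k x)| / ℓ := div_nonneg (abs_nonneg _) hℓ.le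
  calc (∏ j ∈ Finset.univ.erase k, Phi ℓ c j x) * (|tauDeriv (tc ℓ c k x)| / ℓ)
      ≤ 1 * (|tauDeriv (tc ℓ c k x)| / ℓ) := mul_le_mul_of_nonneg_right h1 h4
    _ ≤ 8 * C / ℓ := by rw [one_mul]; exact h3


/-- if `x ∉ Q_c` then some cell coordinate is `< 0` or `≥ 1`. -/
theorem exists_tc_of_not_mem (hℓ : 0 < ℓ) (c : SubIdx n) {x : Space} (hx : x ∉ subCell ℓ c) :
    ∃ i : Fin 3, tc ℓ c i x < 0 ∨ 1 ≤ tc ℓ c i x := by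
  rw [mem_subCell] at hx
  simp only [not_forall, not_and, not_lt] at hx
  obtain ⟨i, hi⟩ := hx
  refine ⟨i, ?_⟩
  by_cases h1 : ℓ * ((c i : ℕ) : ℝ) ≤ x i
  · right
    have h2 := hi h1
    rw [tc, le_div_iff₀ hℓ]; linarith
  · left
    have h1' : x i < ℓ * ((c i : ℕ) : ℝ) := not_le.1 h1
    rw [tc]; exact div_neg_of_neg_of_pos (by linarith) hℓ

/-- **support of the gradient**: `∂_k h_c(x) = 0` for `x ∉ Q_c`. -/
theorem pd_bump_eq_zero_of_not_mem (hℓ : 0 < ℓ) (c : SubIdx n) (k : Fin 3) {x : Space}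
    (hx : x ∉ subCell ℓ c) : pd (bump ℓ c) k x = 0 := by
  rw [pd_bump]
  obtain ⟨i, hi⟩ := exists_tc_of_not_mem hℓ c hx
  by_cases hik : i = k
  · subst hik
    rcases hi with hi | hi
    · rw [tauDeriv_eq_zero_of_nonpos hi.le]; simp
    · rw [tauDeriv_eq_zero_of_one_le hi]; simp
  · have hmem : i ∈ Finset.univ.erase k := Finset.mem_erase.2 ⟨hik, Finset.mem_univ i⟩
    have h0 : Phi ℓ c i x = 0 := by
      rcases hi with hi | hi
      · exact tau_eq_zero_of_nonpos hi.le
      · exact tau_eq_zero_of_one_le hi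
    rw [Finset.prod_eq_zero hmem h0, zero_mul]

/-- gradient bound with support: `|∂_k h_c(x)| ≤ (8C_σ/ℓ)·1_{Q_c}(x)`. -/
theorem abs_pd_bump_le_indicator (hℓ : 0 < ℓ) {C : ℝ} (hC : ∀ x : ℝ, |sigmaDeriv x| ≤ C) (c : SubIdx n)
    (k : Fin 3) (x : Space) :
    |pd (bump ℓ c) k x| ≤ 8 * C / ℓ * (subCell ℓ c).indicator (fun _ => (1 : ℝ)) x := by
  by_cases hx : x ∈ subCell ℓ c
  · rw [Set.indicator_of_mem hx, mul_one]; exact abs_pd_bump_le hℓ hC c k x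
  · rw [Set.indicator_of_notMem hx, mul_zero, pd_bump_eq_zero_of_not_mem hℓ c k hx, abs_zero]

/-! ### The inner gradient shell of cell `c` (coordinate 0): `t₀ ∈ [1/16, 3/16]`, `t_i ∈ [1/4, 3/4]` (`i ≠ 0`). -/

/-- VERBATIM copy of the skeleton's `shell`. -/
abbrev shell (ℓ : ℝ) (c : SubIdx n) : Set Space :=
  {x | ℓ * ((c 0 : ℕ) : ℝ) + ℓ / 16 ≤ x 0 ∧ x 0 ≤ ℓ * ((c 0 : ℕ) : ℝ) + 3 * ℓ / 16 ∧
    ∀ i : Fin 3, i ≠ 0 → ℓ * ((c i : ℕ) : ℝ) + ℓ / 4 ≤ x i ∧ x i ≤ ℓ * ((c i : ℕ) : ℝ) + 3 * ℓ / 4}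

/-- on the shell, `t₀ ∈ [1/16, 3/16]`. -/
theorem tc_zero_mem_of_shell (hℓ : 0 < ℓ) (c : SubIdx n) {x : Space} (hx : x ∈ shell ℓ c) :
    tc ℓ c 0 x ∈ Icc (1 / 16 : ℝ) (3 / 16) := by
  obtain ⟨h1, h2, -⟩ := hx
  constructor
  · rw [tc, le_div_iff₀ hℓ]; linarith
  · rw [tc, div_le_iff₀ hℓ]; linarith

/-- on the shell, `t_i ∈ [1/4, 3/4]` for `i ≠ 0`. -/
theorem tc_mem_of_shell (hℓ : 0 < ℓ) (c : SubIdx n) {x : Space} (hx : x ∈ shell ℓ c) {i : Fin 3} (hi : i ≠ 0) :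
    tc ℓ c i x ∈ Icc (1 / 4 : ℝ) (3 / 4) := by
  obtain ⟨-, -, h⟩ := hx
  obtain ⟨h1, h2⟩ := h i hi
  constructor
  · rw [tc, le_div_iff₀ hℓ]; linarith
  · rw [tc, div_le_iff₀ hℓ]; linarith



/-- the shell lies in the cell. -/
theorem shell_subset_subCell (hℓ : 0 < ℓ) (c : SubIdx n) : shell ℓ c ⊆ subCell ℓ c := by
  intro x hx
  rw [mem_subCell]
  intro i
  by_cases hi : i = 0
  · subst hi; obtain ⟨h1, h2, -⟩ := hx; constructor <;> linarith
  · obtain ⟨h1, h2⟩ := hx.2.2 i hi; constructor <;> linarith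

/-- **shell lower bound**: on the shell, `∂₀ h_c(x) = 4σ′(4t₀)/ℓ ≥ 4c_σ/ℓ`. -/
theorem pd_bump_zero_of_shell (hℓ : 0 < ℓ) (c : SubIdx n) {x : Space} (hx : x ∈ shell ℓ c) :
    pd (bump ℓ c) 0 x = 4 * sigmaDeriv (4 * tc ℓ c 0 x) / ℓ := by
  rw [pd_bump]
  have hprod : ∏ j ∈ Finset.univ.erase (0 : Fin 3), Phi ℓ c j x = 1 :=
    Finset.prod_eq_one fun j hj => tau_eq_one_of_mem (tc_mem_of_shell hℓ c hx (Finset.mem_erase.1 hj).1)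
  rw [hprod, one_mul, tauDeriv_eq_of_mem (by linarith [(tc_zero_mem_of_shell hℓ c hx).2])]

/-- on the shell, `∂₀ h_c ≥ 4c_σ/ℓ`. -/
theorem le_pd_bump_zero_of_shell (hℓ : 0 < ℓ) {cσ : ℝ} (hcσ : ∀ x ∈ Icc (1 / 4 : ℝ) (3 / 4), cσ ≤ sigmaDeriv x)
    (c : SubIdx n) {x : Space} (hx : x ∈ shell ℓ c) : 4 * cσ / ℓ ≤ pd (bump ℓ c) 0 x := by
  rw [pd_bump_zero_of_shell hℓ c hx]
  have ht := tc_zero_mem_of_shell hℓ c hx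
  have h := hcσ (4 * tc ℓ c 0 x) ⟨by linarith [ht.1], by linarith [ht.2]⟩
  exact div_le_div_of_nonneg_right (by linarith) hℓ.le

/-- on the shell of `c`, the gradient of every OTHER cell's bump vanishes (distinct cells are disjoint). -/
theorem pd_bump_eq_zero_of_shell_of_ne (hℓ : 0 < ℓ) {c c' : SubIdx n} (hcc : c ≠ c') (k : Fin 3) {x : Space}
    (hx : x ∈ shell ℓ c) : pd (bump ℓ c') k x = 0 := by
  refine pd_bump_eq_zero_of_not_mem hℓ c' k fun hx' => ?_
  have hxc := shell_subset_subCell hℓ c hx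
  rw [mem_subCell] at hxc hx'
  apply hcc
  funext i
  have h1 := hxc i; have h2 := hx' i
  have hlt1 : ((c i : ℕ) : ℝ) < (c' i : ℕ) + 1 := by
    by_contra h; have h' := not_lt.1 h; nlinarith [h1.1, h2.2]
  have hlt2 : ((c' i : ℕ) : ℝ) < (c i : ℕ) + 1 := by
    by_contra h; have h' := not_lt.1 h; nlinarith [h1.2, h2.1]
  have : (c i : ℕ) = (c' i : ℕ) := by
    have a : (c i : ℕ) < (c' i : ℕ) + 1 := by exact_mod_cast hlt1
    have b : (c' i : ℕ) < (c i : ℕ) + 1 := by exact_mod_cast hlt2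
    omega
  exact Fin.ext this

/-- **shell floor for the bump DIFFERENCE** `g = h_c − h_c'` (`c' ≠ c`): `(∂₀ g(x))² ≥ (4c_σ/ℓ)²` on the shell of `c`. -/
theorem sq_pd_sub_ge_of_shell (hℓ : 0 < ℓ) {cσ : ℝ} (hcσ0 : 0 ≤ cσ)
    (hcσ : ∀ x ∈ Icc (1 / 4 : ℝ) (3 / 4), cσ ≤ sigmaDeriv x) {c c' : SubIdx n} (hcc : c ≠ c') {x : Space}
    (hx : x ∈ shell ℓ c) (hdiff : DifferentiableAt ℝ (bump ℓ c) x ∧ DifferentiableAt ℝ (bump ℓ c') x) :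
    (4 * cσ / ℓ) ^ 2 ≤ (pd (fun y => bump ℓ c y - bump ℓ c' y) 0 x) ^ 2 := by
  have hsub : pd (fun y => bump ℓ c y - bump ℓ c' y) 0 x = pd (bump ℓ c) 0 x - pd (bump ℓ c') 0 x := by
    simp only [pd]
    rw [fderiv_fun_sub hdiff.1 hdiff.2]; rfl
  rw [hsub, pd_bump_eq_zero_of_shell_of_ne hℓ hcc 0 hx, sub_zero]
  have h := le_pd_bump_zero_of_shell hℓ hcσ c hx
  have h0 : 0 ≤ 4 * cσ / ℓ := by positivity
  exact pow_le_pow_left₀ h0 h 2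

/-- the bumps are `C^∞`. -/
theorem contDiff_bump {m : ℕ∞} (ℓ : ℝ) (c : SubIdx n) : ContDiff ℝ m (bump ℓ c) := by
  rw [bump_eq_prod]
  refine contDiff_prod fun j _ => ?_
  have h1 : ContDiff ℝ m fun x : Space => tc ℓ c j x := by
    unfold tc
    exact (((EuclideanSpace.proj j : Space →L[ℝ] ℝ).contDiff).sub contDiff_const).div_const ℓ
  have hτ : ContDiff ℝ m tau :=
    (Real.smoothTransition.contDiff.comp (contDiff_const.mul contDiff_id)).mul
      (Real.smoothTransition.contDiff.comp (contDiff_const.mul (contDiff_const.sub contDiff_id)))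
  exact hτ.comp h1

/-- the bumps are differentiable. -/
theorem differentiableAt_bump (ℓ : ℝ) (c : SubIdx n) (x : Space) : DifferentiableAt ℝ (bump ℓ c) x :=
  ((contDiff_bump (m := 1) ℓ c).differentiable (by norm_num)).differentiableAt

/-! ### Second derivatives: `∂_k∂_k h_c = (∏_{j≠k} Φ_j)·τ″(t_k)/ℓ²`, `|∂_k∂_k h_c| ≤ C₂/ℓ² · 1_{Q_c}` -/


/-- Fréchet derivative of `y ↦ τ′(t_k(y))/ℓ`. -/
theorem hasFDerivAt_tcDeriv (c : SubIdx n) (k : Fin 3) (x : Space) :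
    HasFDerivAt (fun y : Space => tauDeriv (tc ℓ c k y) / ℓ)
      ((deriv tauDeriv (tc ℓ c k x) / ℓ / ℓ) • (EuclideanSpace.proj k : Space →L[ℝ] ℝ)) x := by
  have h1 : HasDerivAt (fun s : ℝ => tauDeriv ((s - ℓ * ((c k : ℕ) : ℝ)) / ℓ) / ℓ)
      (deriv tauDeriv (tc ℓ c k x) * (1 / ℓ) / ℓ) (x k) :=
    ((hasDerivAt_tauDeriv _).comp (x k) (((hasDerivAt_id' (x k)).sub_const _).div_const ℓ)).div_const ℓ
  have h2 : HasFDerivAt (fun y : Space => y k) (EuclideanSpace.proj k : Space →L[ℝ] ℝ) x :=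
    (EuclideanSpace.proj k : Space →L[ℝ] ℝ).hasFDerivAt
  have h := h1.comp_hasFDerivAt x h2
  refine h.congr_fderiv ?_
  rw [mul_one_div]

/-- Fréchet derivative of `∏_{j ≠ k} Φ_j`. -/
theorem hasFDerivAt_prodErase (c : SubIdx n) (k : Fin 3) (x : Space) :
    HasFDerivAt (fun y : Space => ∏ j ∈ Finset.univ.erase k, Phi ℓ c j y)
      (∑ i ∈ Finset.univ.erase k, (∏ j ∈ (Finset.univ.erase k).erase i, Phi ℓ c j x) •
        ((tauDeriv (tc ℓ c i x) / ℓ) • (EuclideanSpace.proj i : Space →L[ℝ] ℝ))) x :=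
  HasFDerivAt.finsetProd fun i _ => hasFDerivAt_Phi c i x

/-- **second-derivative formula**: `∂_k∂_k h_c(x) = (∏_{j ≠ k} Φ_j(x)) · τ″(t_k(x))/ℓ²`. -/
theorem pd_pd_bump (c : SubIdx n) (k : Fin 3) (x : Space) :
    pd (pd (bump ℓ c) k) k x = (∏ j ∈ Finset.univ.erase k, Phi ℓ c j x) * (deriv tauDeriv (tc ℓ c k x) / ℓ / ℓ) := by
  have hfun : pd (bump ℓ c) k = fun y => (∏ j ∈ Finset.univ.erase k, Phi ℓ c j y) * (tauDeriv (tc ℓ c k y) / ℓ) :=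
    funext fun y => pd_bump c k y
  rw [pd, hfun, fderiv_fun_mul (hasFDerivAt_prodErase c k x).differentiableAt (hasFDerivAt_tcDeriv c k x).differentiableAt,
    (hasFDerivAt_prodErase c k x).fderiv, (hasFDerivAt_tcDeriv c k x).fderiv]
  have hP' : (∑ i ∈ Finset.univ.erase k, (∏ j ∈ (Finset.univ.erase k).erase i, Phi ℓ c j x) •
      ((tauDeriv (tc ℓ c i x) / ℓ) • (EuclideanSpace.proj i : Space →L[ℝ] ℝ))) (e k) = 0 := by
    rw [sum_apply]
    refine Finset.sum_eq_zero fun i hi => ?_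
    have hik : i ≠ k := (Finset.mem_erase.1 hi).1
    rw [smul_apply, smul_apply, proj_e, if_neg hik, smul_zero, smul_zero]
  rw [add_apply, smul_apply, smul_apply, smul_apply, hP', smul_zero, add_zero, proj_e, if_pos rfl,
    smul_eq_mul, smul_eq_mul, mul_one]

/-- **second-derivative sup bound**: `|∂_k∂_k h_c| ≤ C₂/ℓ²` (`C₂` = a global bound of `|τ″|`, `ℓ > 0`). -/
theorem abs_pd_pd_bump_le (hℓ : 0 < ℓ) {C₂ : ℝ} (hC₂ : ∀ t : ℝ, |deriv tauDeriv t| ≤ C₂) (c : SubIdx n)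
    (k : Fin 3) (x : Space) : |pd (pd (bump ℓ c) k) k x| ≤ C₂ / ℓ ^ 2 := by
  rw [pd_pd_bump, abs_mul, abs_of_nonneg (prod_Phi_nonneg c _ x), div_div, ← sq, abs_div, abs_of_pos (pow_pos hℓ 2)]
  have h1 := prod_Phi_le_one (ℓ := ℓ) c (Finset.univ.erase k) x
  have h3 : |deriv tauDeriv (tc ℓ c k x)| / ℓ ^ 2 ≤ C₂ / ℓ ^ 2 :=
    div_le_div_of_nonneg_right (hC₂ _) (pow_pos hℓ 2).le
  have h4 : 0 ≤ |deriv tauDeriv (tc ℓ c k x)| / ℓ ^ 2 := div_nonneg (abs_nonneg _) (pow_pos hℓ 2).le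
  calc (∏ j ∈ Finset.univ.erase k, Phi ℓ c j x) * (|deriv tauDeriv (tc ℓ c k x)| / ℓ ^ 2)
      ≤ 1 * (|deriv tauDeriv (tc ℓ c k x)| / ℓ ^ 2) := mul_le_mul_of_nonneg_right h1 h4
    _ ≤ C₂ / ℓ ^ 2 := by rw [one_mul]; exact h3

/-- **support of the second derivative**: `∂_k∂_k h_c(x) = 0` for `x ∉ Q_c`. -/
theorem pd_pd_bump_eq_zero_of_not_mem (hℓ : 0 < ℓ) (c : SubIdx n) (k : Fin 3) {x : Space}
    (hx : x ∉ subCell ℓ c) : pd (pd (bump ℓ c) k) k x = 0 := by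
  rw [pd_pd_bump]
  obtain ⟨i, hi⟩ := exists_tc_of_not_mem hℓ c hx
  by_cases hik : i = k
  · subst hik
    rcases hi with hi | hi
    · rw [deriv_tauDeriv_eq_zero_of_nonpos hi.le]; simp
    · rw [deriv_tauDeriv_eq_zero_of_one_le hi]; simp
  · have hmem : i ∈ Finset.univ.erase k := Finset.mem_erase.2 ⟨hik, Finset.mem_univ i⟩
    have h0 : Phi ℓ c i x = 0 := by
      rcases hi with hi | hi
      · exact tau_eq_zero_of_nonpos hi.le
      · exact tau_eq_zero_of_one_le hi
    rw [Finset.prod_eq_zero hmem h0, zero_mul]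

/-- second-derivative bound with support: `|∂_k∂_k h_c(x)| ≤ (C₂/ℓ²)·1_{Q_c}(x)`. -/
theorem abs_pd_pd_bump_le_indicator (hℓ : 0 < ℓ) {C₂ : ℝ} (hC₂ : ∀ t : ℝ, |deriv tauDeriv t| ≤ C₂) (c : SubIdx n)
    (k : Fin 3) (x : Space) :
    |pd (pd (bump ℓ c) k) k x| ≤ C₂ / ℓ ^ 2 * (subCell ℓ c).indicator (fun _ => (1 : ℝ)) x := by
  by_cases hx : x ∈ subCell ℓ c
  · rw [Set.indicator_of_mem hx, mul_one]; exact abs_pd_pd_bump_le hℓ hC₂ c k x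
  · rw [Set.indicator_of_notMem hx, mul_zero, pd_pd_bump_eq_zero_of_not_mem hℓ c k hx, abs_zero]

/-- the first partials are differentiable (needed to differentiate `∂_k h_c` once more inside sums). -/
theorem differentiableAt_pd_bump (c : SubIdx n) (k : Fin 3) (x : Space) : DifferentiableAt ℝ (pd (bump ℓ c) k) x := by
  have hfun : pd (bump ℓ c) k = fun y => (∏ j ∈ Finset.univ.erase k, Phi ℓ c j y) * (tauDeriv (tc ℓ c k y) / ℓ) :=
    funext fun y => pd_bump c k y
  rw [hfun]
  exact (hasFDerivAt_prodErase c k x).differentiableAt.mul (hasFDerivAt_tcDeriv c k x).differentiableAt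

end Bump3D

end Summit.AtomisticToContinuum.BoseEinsteinCondensation.Theorems.NumberPhaseSandwichBumpCalculus

end
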